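import Summits.AnomalousDissipation.AnomalousDissipation.Theorems.SolenoidalFractalHomogenisationLagrangianStepLossCurrencyComparability
import Summits.AnomalousDissipation.AnomalousDissipation.Theorems.SolenoidalFractalHomogenisationLagrangianStepCellClauseModDefs
import Summits.AnomalousDissipation.AnomalousDissipation.Theorems.SolenoidalFractalHomogenisationLagrangianStepCellInputsBilinearLeray
import HarnessLib

/-!
# K1L_D (stmt-AnomalousDissipation-27980), §9z glue v2, steps (b)(c): EULERIAN COMPOSITION of the two refresh pieces in loss currency
# (helper; `--supports … --as helper`; lead-k1l-onelevel-p1 g5; memo L12 §3)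

The §9z window `[jR, s′]` of `stub_cellInputs` is the cocycle product of the full refresh piece `[jR, r₁]` and the post-refresh piece `[r₁, s′]`
(`r₁ = (j+1)R`, arbitrary length `≤ R`).  Given, for the Eulerian pair (true `Um1`, coarse `Um`) of `Torus.IsPropagator` families, a
loss-currency bound on EACH piece (`|⟪(Um1 − Um)(a,b)x, ζ⟫| ≤ η·√lossFwd(Um a b)x·√lossAdj(Um a b)ζ`, delivered per piece by the frame
conjugacy + (V_modEC), file `…Z7GlueEulerian`), this file composes them with `LossCurrency.lossBound_comp_raw` (p693550) and converts the four
resulting losses with the αβ-text facts (N1)/(N1*) (full-window N-conversion) and (N2) (loss-rate monotonicity across `r₁`), the two remaining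
conversions being algebraic (`loss_le_loss_comp`, `lossAdj_le_lossAdj_comp`, `lossAdj_adjoint_le_lossAdj_comp`):

* `comp_bound_explicit` — generic real Hilbert space: the composite bound with the explicit constant `(η₂(√(2·Cmono·r) + √2·η₁) + η₁)·CN`;
* `lossBound_of_divFree` / `lossBound_of_divFree_propagator` — a loss-currency bound for weakly divergence-free data implies it for all data
  (window maps see only `P_σ`, have solenoidal range, and `T† = T† ∘ P_σ`);
* `eulerian_compose` — the two-piece statement for `IsPropagator` families on `[0,1]`.

Pure Hilbert-space algebra; NOT a proof of §9z, of the crux, or of AD; rung F-D1.A0.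
-/

set_option linter.dupNamespace false  -- the summit-side namespace `Summit.AnomalousDissipation.AnomalousDissipation.…` repeats a component by design (D-0017)

noncomputable section

namespace Summit.AnomalousDissipation.AnomalousDissipation.Theorems.SolenoidalFractalHomogenisation.LagrangianStep.Z7Glue

open Literature.Analysis Literature.Analysis.FluidPDE Literature.Analysis.FunctionSpaces
open MeasureTheory
open scoped InnerProductSpace
open Summit.AnomalousDissipation.AnomalousDissipation.Theorems.SolenoidalFractalHomogenisation.LagrangianStep.LossCurrency
open Summit.AnomalousDissipation.AnomalousDissipation.Theorems.SolenoidalFractalHomogenisation.LagrangianStep.CellClauseMod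

/-! ## §1 Generic real Hilbert space: the composite bound with explicit constant -/

section Generic

variable {H : Type*} [NormedAddCommGroup H] [InnerProductSpace ℝ H] [CompleteSpace H]

/-- `√(a + b) ≤ √a + √b`. -/
theorem sqrt_add_le_sqrt_add_sqrt (a b : ℝ) : Real.sqrt (a + b) ≤ Real.sqrt a + Real.sqrt b := by
  rcases le_or_gt a 0 with ha | ha
  · calc Real.sqrt (a + b) ≤ Real.sqrt b := Real.sqrt_le_sqrt (by linarith)
      _ ≤ Real.sqrt a + Real.sqrt b := le_add_of_nonneg_left (Real.sqrt_nonneg _)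
  rcases le_or_gt b 0 with hb | hb
  · calc Real.sqrt (a + b) ≤ Real.sqrt a := Real.sqrt_le_sqrt (by linarith)
      _ ≤ Real.sqrt a + Real.sqrt b := le_add_of_nonneg_right (Real.sqrt_nonneg _)
  rw [Real.sqrt_le_left (by positivity)]
  have h1 := Real.sq_sqrt ha.le
  have h2 := Real.sq_sqrt hb.le
  nlinarith [Real.sqrt_nonneg a, Real.sqrt_nonneg b]

/-- **The composite loss-currency bound with explicit constant.**  Two pairs `(U₁,T₁)`, `(U₂,T₂)` (`Tᵢ` contractions) with loss-currency bounds
`η₁, η₂`; if the composite's forward / adjoint losses are `≤ CN·X2`, `≤ CN·Y2` and the second piece dissipates from the prepared datum `T₁x`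
at most `Cmono·r` times what the first piece dissipated from `x`, then
`|⟪(U₂U₁ − T₂T₁)x, ζ⟫| ≤ (η₂(√(2·Cmono·r) + √2·η₁) + η₁)·CN·√X2·√Y2`. -/
theorem comp_bound_explicit {U₁ T₁ U₂ T₂ : H →L[ℝ] H} {η₁ η₂ CN Cmono r X2 Y2 : ℝ}
    (hη₁ : 0 ≤ η₁) (hη₂ : 0 ≤ η₂) (hCN : 0 ≤ CN) (hCm : 0 ≤ Cmono) (hr : 0 ≤ r)
    (hT₁ : ∀ y, ‖T₁ y‖ ≤ ‖y‖) (hT₂ : ∀ y, ‖T₂ y‖ ≤ ‖y‖)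
    (h₁ : ∀ x ζ : H, |⟪U₁ x - T₁ x, ζ⟫_ℝ| ≤ η₁ * Real.sqrt (‖x‖ ^ 2 - ‖T₁ x‖ ^ 2) * Real.sqrt (‖ζ‖ ^ 2 - ‖ContinuousLinearMap.adjoint T₁ ζ‖ ^ 2))
    (h₂ : ∀ x ζ : H, |⟪U₂ x - T₂ x, ζ⟫_ℝ| ≤ η₂ * Real.sqrt (‖x‖ ^ 2 - ‖T₂ x‖ ^ 2) * Real.sqrt (‖ζ‖ ^ 2 - ‖ContinuousLinearMap.adjoint T₂ ζ‖ ^ 2))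
    (x ζ : H)
    (hN1 : ‖x‖ ^ 2 - ‖(T₂.comp T₁) x‖ ^ 2 ≤ CN * X2)
    (hN1s : ‖ζ‖ ^ 2 - ‖ContinuousLinearMap.adjoint (T₂.comp T₁) ζ‖ ^ 2 ≤ CN * Y2)
    (hN2 : ‖T₁ x‖ ^ 2 - ‖T₂ (T₁ x)‖ ^ 2 ≤ Cmono * r * (‖x‖ ^ 2 - ‖T₁ x‖ ^ 2)) :
    |⟪U₂ (U₁ x) - T₂ (T₁ x), ζ⟫_ℝ| ≤ (η₂ * (Real.sqrt (2 * Cmono * r) + Real.sqrt 2 * η₁) + η₁) * CN * Real.sqrt X2 * Real.sqrt Y2 := by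
  have hraw := lossBound_comp_raw hη₁ hη₂ hT₁ hT₂ h₁ h₂ x ζ
  -- the four losses and their conversions
  set A : ℝ := ‖x‖ ^ 2 - ‖T₁ x‖ ^ 2 with hA
  set B : ℝ := ‖T₁ x‖ ^ 2 - ‖T₂ (T₁ x)‖ ^ 2 with hB
  set Cs : ℝ := ‖ζ‖ ^ 2 - ‖ContinuousLinearMap.adjoint T₂ ζ‖ ^ 2 with hCs
  set Ds : ℝ := ‖ContinuousLinearMap.adjoint T₂ ζ‖ ^ 2 - ‖ContinuousLinearMap.adjoint T₁ (ContinuousLinearMap.adjoint T₂ ζ)‖ ^ 2 with hDs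
  have hA0 : 0 ≤ A := loss_nonneg hT₁ x
  have hAQ : A ≤ CN * X2 := (loss_le_loss_comp hT₂ x).trans hN1
  have hCsQ : Cs ≤ CN * Y2 := (lossAdj_le_lossAdj_comp hT₁ ζ).trans hN1s
  have hDsQ : Ds ≤ CN * Y2 := (lossAdj_adjoint_le_lossAdj_comp hT₂ ζ).trans hN1s
  have hBQ : B ≤ Cmono * r * (CN * X2) := hN2.trans (mul_le_mul_of_nonneg_left hAQ (mul_nonneg hCm hr))
  -- square roots
  have hsA : Real.sqrt A ≤ Real.sqrt CN * Real.sqrt X2 := by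
    rw [← Real.sqrt_mul hCN]; exact Real.sqrt_le_sqrt hAQ
  have hsCs : Real.sqrt Cs ≤ Real.sqrt CN * Real.sqrt Y2 := by
    rw [← Real.sqrt_mul hCN]; exact Real.sqrt_le_sqrt hCsQ
  have hsDs : Real.sqrt Ds ≤ Real.sqrt CN * Real.sqrt Y2 := by
    rw [← Real.sqrt_mul hCN]; exact Real.sqrt_le_sqrt hDsQ
  have hsB : Real.sqrt (2 * B + 2 * η₁ ^ 2 * A)
      ≤ (Real.sqrt (2 * Cmono * r) + Real.sqrt 2 * η₁) * (Real.sqrt CN * Real.sqrt X2) := by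
    have h1 : 2 * B + 2 * η₁ ^ 2 * A ≤ (2 * Cmono * r) * (CN * X2) + (2 * η₁ ^ 2) * (CN * X2) := by
      nlinarith [sq_nonneg η₁]
    have e1 : Real.sqrt ((2 * Cmono * r) * (CN * X2)) = Real.sqrt (2 * Cmono * r) * (Real.sqrt CN * Real.sqrt X2) := by
      rw [Real.sqrt_mul (by positivity : (0:ℝ) ≤ 2 * Cmono * r), Real.sqrt_mul hCN]
    have e2 : Real.sqrt ((2 * η₁ ^ 2) * (CN * X2)) = Real.sqrt 2 * η₁ * (Real.sqrt CN * Real.sqrt X2) := by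
      have h2η : Real.sqrt (2 * η₁ ^ 2) = Real.sqrt 2 * η₁ := by
        rw [Real.sqrt_mul (by norm_num : (0:ℝ) ≤ 2), Real.sqrt_sq hη₁]
      rw [Real.sqrt_mul (by positivity : (0:ℝ) ≤ 2 * η₁ ^ 2), Real.sqrt_mul hCN, h2η]
    calc Real.sqrt (2 * B + 2 * η₁ ^ 2 * A)
        ≤ Real.sqrt ((2 * Cmono * r) * (CN * X2) + (2 * η₁ ^ 2) * (CN * X2)) := Real.sqrt_le_sqrt h1
      _ ≤ Real.sqrt ((2 * Cmono * r) * (CN * X2)) + Real.sqrt ((2 * η₁ ^ 2) * (CN * X2)) := sqrt_add_le_sqrt_add_sqrt _ _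
      _ = (Real.sqrt (2 * Cmono * r) + Real.sqrt 2 * η₁) * (Real.sqrt CN * Real.sqrt X2) := by rw [e1, e2]; ring
  have hS2 : 0 ≤ Real.sqrt (2 * Cmono * r) + Real.sqrt 2 * η₁ := by positivity
  have hSCN : 0 ≤ Real.sqrt CN := Real.sqrt_nonneg _
  have hSX : 0 ≤ Real.sqrt X2 := Real.sqrt_nonneg _
  have hSY : 0 ≤ Real.sqrt Y2 := Real.sqrt_nonneg _
  have hterm1 : η₂ * Real.sqrt (2 * B + 2 * η₁ ^ 2 * A) * Real.sqrt Cs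
      ≤ η₂ * ((Real.sqrt (2 * Cmono * r) + Real.sqrt 2 * η₁) * (Real.sqrt CN * Real.sqrt X2)) * (Real.sqrt CN * Real.sqrt Y2) :=
    mul_le_mul (mul_le_mul_of_nonneg_left hsB hη₂) hsCs (Real.sqrt_nonneg _) (mul_nonneg hη₂ (by positivity))
  have hterm2 : η₁ * Real.sqrt A * Real.sqrt Ds ≤ η₁ * (Real.sqrt CN * Real.sqrt X2) * (Real.sqrt CN * Real.sqrt Y2) :=
    mul_le_mul (mul_le_mul_of_nonneg_left hsA hη₁) hsDs (Real.sqrt_nonneg _) (mul_nonneg hη₁ (by positivity))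
  have hCNsq : Real.sqrt CN * Real.sqrt CN = CN := Real.mul_self_sqrt hCN
  calc |⟪U₂ (U₁ x) - T₂ (T₁ x), ζ⟫_ℝ|
      ≤ η₂ * Real.sqrt (2 * B + 2 * η₁ ^ 2 * A) * Real.sqrt Cs + η₁ * Real.sqrt A * Real.sqrt Ds := hraw
    _ ≤ η₂ * ((Real.sqrt (2 * Cmono * r) + Real.sqrt 2 * η₁) * (Real.sqrt CN * Real.sqrt X2)) * (Real.sqrt CN * Real.sqrt Y2)
        + η₁ * (Real.sqrt CN * Real.sqrt X2) * (Real.sqrt CN * Real.sqrt Y2) := add_le_add hterm1 hterm2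
    _ = (η₂ * (Real.sqrt (2 * Cmono * r) + Real.sqrt 2 * η₁) + η₁) * (Real.sqrt CN * Real.sqrt CN) * Real.sqrt X2 * Real.sqrt Y2 := by
        ring
    _ = (η₂ * (Real.sqrt (2 * Cmono * r) + Real.sqrt 2 * η₁) + η₁) * CN * Real.sqrt X2 * Real.sqrt Y2 := by rw [hCNsq]

end Generic

/-! ## §2 `V2`: a loss-currency bound on divergence-free data is one on all data -/

/-- The adjoint of a map with weakly divergence-free range sees only `P_σ` of its argument: `T† ζ = T† (P_σ ζ)`. -/
theorem adjoint_apply_eq_adjoint_starProjection (T : V2 →L[ℝ] V2) (hTr : ∀ x : V2, Torus.IsWeaklyDivFree (⇑(T x) : VF)) (ζ : V2) :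
    ContinuousLinearMap.adjoint T ζ = ContinuousLinearMap.adjoint T ((Torus.divFreeL2 (Fin 3)).starProjection ζ) := by
  rw [← sub_eq_zero, ← map_sub]
  refine ext_inner_right ℝ fun v => ?_
  rw [ContinuousLinearMap.adjoint_inner_left, inner_zero_left]
  have hmem : T v ∈ Torus.divFreeL2 (Fin 3) := (Torus.mem_divFreeL2_iff _).2 (hTr v)
  exact (Torus.divFreeL2 (Fin 3)).inner_left_of_mem_orthogonal hmem ((Torus.divFreeL2 (Fin 3)).sub_starProjection_mem_orthogonal ζ)

/-- **Loss-currency bound: divergence-free data suffice.**  Let `U, T : V2 →L[ℝ] V2` see only `P_σ` of their argument and have weakly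
divergence-free range.  If `|⟪U x − T x, ζ⟫| ≤ η·√lossFwd T x·√lossAdj T ζ` for weakly divergence-free `x, ζ`, then for all `x, ζ`
(`⟪(U−T)x, ζ⟫ = ⟪(U−T)P_σx, P_σζ⟫`, `lossFwd T (P_σ x) ≤ lossFwd T x`, `lossAdj T (P_σ ζ) ≤ lossAdj T ζ` as `T† = T†P_σ`). -/
theorem lossBound_of_divFree (U T : V2 →L[ℝ] V2) {η : ℝ} (hη : 0 ≤ η)
    (hU : ∀ x : V2, U x = U ((Torus.divFreeL2 (Fin 3)).starProjection x))
    (hT : ∀ x : V2, T x = T ((Torus.divFreeL2 (Fin 3)).starProjection x))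
    (hUr : ∀ x : V2, Torus.IsWeaklyDivFree (⇑(U x) : VF)) (hTr : ∀ x : V2, Torus.IsWeaklyDivFree (⇑(T x) : VF))
    (h : ∀ x ζ : V2, Torus.IsWeaklyDivFree (⇑x : VF) → Torus.IsWeaklyDivFree (⇑ζ : VF) →
      |⟪U x - T x, ζ⟫_ℝ| ≤ η * Real.sqrt (lossFwd T x) * Real.sqrt (lossAdj T ζ)) :
    ∀ x ζ : V2, |⟪U x - T x, ζ⟫_ℝ| ≤ η * Real.sqrt (lossFwd T x) * Real.sqrt (lossAdj T ζ) := by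
  intro x ζ
  set K := Torus.divFreeL2 (Fin 3) with hK
  set Px := K.starProjection x with hPx
  set Pζ := K.starProjection ζ with hPζ
  have hmem : U Px - T Px ∈ K :=
    K.sub_mem ((Torus.mem_divFreeL2_iff _).2 (hUr Px)) ((Torus.mem_divFreeL2_iff _).2 (hTr Px))
  have horth : ⟪U Px - T Px, ζ - Pζ⟫_ℝ = 0 := K.inner_right_of_mem_orthogonal hmem (K.sub_starProjection_mem_orthogonal ζ)
  have e1 : ⟪U x - T x, ζ⟫_ℝ = ⟪U Px - T Px, Pζ⟫_ℝ := by
    rw [hU x, hT x, ← hPx]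
    have eζ : ζ = Pζ + (ζ - Pζ) := by abel
    conv_lhs => rw [eζ]
    rw [inner_add_right, horth, add_zero]
  rw [e1]
  have hxd : Torus.IsWeaklyDivFree (⇑Px : VF) := (Torus.mem_divFreeL2_iff _).1 (K.starProjection_apply_mem x)
  have hζd : Torus.IsWeaklyDivFree (⇑Pζ : VF) := (Torus.mem_divFreeL2_iff _).1 (K.starProjection_apply_mem ζ)
  refine (h Px Pζ hxd hζd).trans ?_
  -- the two losses only grow when the projection is removed
  have hF : lossFwd T Px ≤ lossFwd T x := by
    unfold lossFwd
    rw [hPx, ← hT x]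
    have hn : ‖K.starProjection x‖ ≤ ‖x‖ := K.norm_starProjection_apply_le x
    nlinarith [norm_nonneg (K.starProjection x), norm_nonneg x]
  have hAd : lossAdj T Pζ ≤ lossAdj T ζ := by
    unfold lossAdj
    rw [hPζ, ← adjoint_apply_eq_adjoint_starProjection T hTr ζ]
    have hn : ‖K.starProjection ζ‖ ≤ ‖ζ‖ := K.norm_starProjection_apply_le ζ
    nlinarith [norm_nonneg (K.starProjection ζ), norm_nonneg ζ]
  have h1 := Real.sqrt_le_sqrt hF
  have h2 := Real.sqrt_le_sqrt hAd
  exact mul_le_mul (mul_le_mul_of_nonneg_left h1 hη) h2 (Real.sqrt_nonneg _) (mul_nonneg hη (Real.sqrt_nonneg _))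

/-- **Divergence-free data suffice for two PROPAGATOR window maps** `Um1 a b`, `Um a b` of `Torus.IsPropagator` families. -/
theorem lossBound_of_divFree_propagator {T₀ : ℝ} {bm bm1 : ℝ → VF} {𝔸m 𝔸m1 : Torus.Visc4 (Fin 3)} {Um Um1 : ℝ → ℝ → (V2 →L[ℝ] V2)}
    (hUm : Torus.IsPropagator T₀ bm 𝔸m Um) (hUm1 : Torus.IsPropagator T₀ bm1 𝔸m1 Um1) (a b : ℝ) {η : ℝ} (hη : 0 ≤ η)
    (h : ∀ x ζ : V2, Torus.IsWeaklyDivFree (⇑x : VF) → Torus.IsWeaklyDivFree (⇑ζ : VF) →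
      |⟪Um1 a b x - Um a b x, ζ⟫_ℝ| ≤ η * Real.sqrt (lossFwd (Um a b) x) * Real.sqrt (lossAdj (Um a b) ζ)) :
    ∀ x ζ : V2, |⟪Um1 a b x - Um a b x, ζ⟫_ℝ| ≤ η * Real.sqrt (lossFwd (Um a b) x) * Real.sqrt (lossAdj (Um a b) ζ) :=
  lossBound_of_divFree (Um1 a b) (Um a b) hη
    (fun x => hUm1.apply_eq_apply_starProjection a b x) (fun x => hUm.apply_eq_apply_starProjection a b x)
    (fun x => hUm1.divFree a b x) (fun x => hUm.divFree a b x) h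

/-! ## §3 The two-piece Eulerian composition for propagator families -/

/-- **EULERIAN TWO-PIECE COMPOSITION.**  `Um`, `Um1` propagator families on `[0,T₀]`, times `0 ≤ s ≤ r ≤ t ≤ T₀`; loss-currency bounds `η₁` on
`[s,r]` and `η₂` on `[r,t]` for the pair `(Um1, Um)`; the full-window N-conversions `lossFwd (Um s t) x ≤ CN·X2`, `lossAdj (Um s t) y ≤ CN·Y2`
and the loss-rate monotonicity `lossFwd (Um r t) (Um s r x) ≤ Cmono·ρr·lossFwd (Um s r) x`.  Then
`|⟪Um1 s t x − Um s t x, y⟫| ≤ (η₂(√(2·Cmono·ρr) + √2·η₁) + η₁)·CN·√X2·√Y2`. -/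
theorem eulerian_compose {T₀ : ℝ} {bm bm1 : ℝ → VF} {𝔸m 𝔸m1 : Torus.Visc4 (Fin 3)} {Um Um1 : ℝ → ℝ → (V2 →L[ℝ] V2)}
    (hUm : Torus.IsPropagator T₀ bm 𝔸m Um) (hUm1 : Torus.IsPropagator T₀ bm1 𝔸m1 Um1)
    {s r t : ℝ} (hs : 0 ≤ s) (hsr : s ≤ r) (hrt : r ≤ t) (ht : t ≤ T₀)
    {η₁ η₂ CN Cmono ρr X2 Y2 : ℝ}
    (hη₁ : 0 ≤ η₁) (hη₂ : 0 ≤ η₂) (hCN : 0 ≤ CN) (hCm : 0 ≤ Cmono) (hρr : 0 ≤ ρr)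
    (h₁ : ∀ x ζ : V2, |⟪Um1 s r x - Um s r x, ζ⟫_ℝ| ≤ η₁ * Real.sqrt (lossFwd (Um s r) x) * Real.sqrt (lossAdj (Um s r) ζ))
    (h₂ : ∀ x ζ : V2, |⟪Um1 r t x - Um r t x, ζ⟫_ℝ| ≤ η₂ * Real.sqrt (lossFwd (Um r t) x) * Real.sqrt (lossAdj (Um r t) ζ))
    (x y : V2)
    (hN1 : lossFwd (Um s t) x ≤ CN * X2) (hN1s : lossAdj (Um s t) y ≤ CN * Y2)
    (hN2 : lossFwd (Um r t) (Um s r x) ≤ Cmono * ρr * lossFwd (Um s r) x) :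
    |⟪Um1 s t x - Um s t x, y⟫_ℝ| ≤ (η₂ * (Real.sqrt (2 * Cmono * ρr) + Real.sqrt 2 * η₁) + η₁) * CN * Real.sqrt X2 * Real.sqrt Y2 := by
  -- cocycles
  have hU1c : Um1 s t x = Um1 r t (Um1 s r x) := (hUm1.comp s r t hs hsr hrt ht x).symm
  have hUc : Um s t x = Um r t (Um s r x) := (hUm.comp s r t hs hsr hrt ht x).symm
  have hUcomp : (Um r t).comp (Um s r) = Um s t := ContinuousLinearMap.ext fun z => hUm.comp s r t hs hsr hrt ht z
  rw [hU1c, hUc]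
  unfold lossFwd at h₁ h₂ hN1 hN2
  unfold lossAdj at h₁ h₂ hN1s
  rw [← hUcomp] at hN1 hN1s
  exact comp_bound_explicit hη₁ hη₂ hCN hCm hρr (hUm.norm_le s r) (hUm.norm_le r t) h₁ h₂ x y hN1 hN1s hN2

end Summit.AnomalousDissipation.AnomalousDissipation.Theorems.SolenoidalFractalHomogenisation.LagrangianStep.Z7Glue

end
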